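import Mathlib.Combinatorics.SetFamily.FourFunctions
import Mathlib.Tactic
import HarnessLib
import HarnessLib.Audit.Tags
import Summits.CriticalPhenomena.PercolationContinuityZ3.Theorems.PercNearOneGluingNoHeavyLowerTailSahiPartitionDaykin

/-!
# The TYPE-SET form of signed coloured Daykin (`TypeSetSignedDaykin`) and its reduction to `PartitionSignedDaykin`

Support file (seat `prim-masterthm-p1`, gen 43; `--supports stmt-CriticalPhenomena-4575`).  One typed conjecture with its
vocabulary (`tcompat`, `flipT`, `lcompat`, `typeMeets`), one reduction; no `sorry`, standard axioms.
Memo `run/shared/lean/prim/prim-masterthm/FROM-prim-masterthm-p1-g43-TYPE-SETS.md` (§1–§2), engines `prim-masterthm-p1/code-g43/`.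

THE Z-LANGUAGE ([this work]).  `PartitionSignedDaykin` (gen 33; ⟹ `SignedColouredDaykin3` ⟹ `CrossSignedColouredDaykin3`, the
statement the three-petal reduction of gens 26–28 needs) is, after adjoining complements, a statement about a COMPLEMENT-CLOSED
family `Z = P ⊔ σP ⊆ 2^G` whose members carry a TYPE `(class, sign) ∈ ℕ × Bool` with `type (G \ z) = flipT (type z)`: two types are
COMPATIBLE iff `[classes equal] XOR [signs equal]` (the graph `K_k □ K_2`), and `partDiffs` is exactly the set of meets `z ∩ z'` of
compatible pairs (same class & opposite signs = a difference, different classes & equal signs = a meet or a complemented join).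
Compression at a point `y` (the engine of every inductive proof in this programme, gens 33–42) does NOT preserve this structure: the
projection `z \ y` inherits the types of BOTH lifts `z \ y`, `z ∪ {y}` when both are members.  The natural compression-closed class is
therefore: every member carries a nonempty SET of types `L z ⊆ ℕ × Bool`, equivariant (`L (G \ z) = flipT '' L z`), two members are
compatible iff SOME pair of their types is, a member is SELF-compatible iff its own type-set contains a compatible pair (then
`z = z ∩ z` counts), and the weight of an antipodal pair `{z, G \ z}` is `1 + [z self-compatible]`.

* `TypeSetSignedDaykin` (typed, [status: open]): `#Z + #{z ∈ Z : z self-compatible} ≤ 2 · #typeMeets Z L`.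
  Singleton type-sets = `PartitionSignedDaykin` (`partitionSignedDaykin_of_typeSetSignedDaykin`, this file); type-sets
  `{(c,+),(c,-)}` = complementary pairs inside one class (Marica–Schönheim for families WITH complementary pairs); under compression
  the projected family with the UNION type-sets is again an instance and its compatible meets are EXACTLY the projections of the
  compatible meets of `Z` (memo §2: `slack(Z) = slack(Z'_y) + tw_y − def_y`, an identity).
* EVIDENCE (memo §1; `code-g43/c/psd.c`, `psdinf.c`, `shapes.c`, kit j310282): the singleton/within-class sub-case holds for ALL
  16 699 434 configurations on `2^4` with ≤ 3 classes and all 35 451 825 with ≤ 4 classes (105 505 / 187 568 tight), all 1 794 on `2^3`;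
  the general type-set statement holds for all 3 111 695 configurations on `2^3` with type-sets of size ≤ 3 from 3 classes and in
  > 2·10⁷ annealed evaluations biased towards small slack on `2^4, 2^5, 2^6` (3–5 classes, type-sets of size ≤ 4; hundreds of thousands
  tight, 0 violations).  The weight `1 + [self-compatible]` is the largest per-pair weight consistent with the data (a lone pair
  `{u, G \ u}` has exactly `1 + 2·[self-compatible]` compatible meets, `3` not `4` for `L = {(1,+),(2,+),(3,+),(4,+)}`).
HONEST FRAMING: a conjecture (strictly stronger than `PartitionSignedDaykin`) and a reduction; nothing here is claimed proved
about the conjectures. [this work]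
-/

namespace Summit.CriticalPhenomena.PercolationContinuityZ3.Theorems.SahiColouredDaykin

open Finset

variable {α : Type*} [DecidableEq α]

/-! ### 1. Types, compatibility, type-sets -/

/-- A TYPE is `(class, sign)`; two types are **compatible** iff `[classes equal] XOR [signs equal]`, i.e. same class and opposite
signs (a within-class difference) or different classes and equal signs (a cross-class meet / complemented join). Boolean-valued so
that no instances are needed. [this work] -/
def tcompat (t u : ℕ × Bool) : Bool := (decide (t.1 = u.1)) != (decide (t.2 = u.2))

/-- The sign flip `(c, s) ↦ (c, ¬s)`: the type of the complement. [this work] -/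
def flipT (t : ℕ × Bool) : ℕ × Bool := (t.1, !t.2)

/-- Two TYPE-SETS are compatible iff some pair of their types is (Boolean-valued). [this work] -/
def lcompat (A B : Finset (ℕ × Bool)) : Bool := decide (∃ t ∈ A, ∃ u ∈ B, tcompat t u = true)

/-- Unpacking `lcompat`. [this work] -/
theorem lcompat_iff (A B : Finset (ℕ × Bool)) : lcompat A B = true ↔ ∃ t ∈ A, ∃ u ∈ B, tcompat t u = true := by
  unfold lcompat
  rw [decide_eq_true_iff]

/-- The **compatible meets** of a family with type-sets: `z ∩ z'` over all ordered pairs of members with compatible type-sets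
(including `z = z'` when `L z` is self-compatible). [this work] -/
def typeMeets (Z : Finset (Finset α)) (L : Finset α → Finset (ℕ × Bool)) : Finset (Finset α) :=
  ((Z ×ˢ Z).filter fun p : Finset α × Finset α => lcompat (L p.1) (L p.2) = true).image fun p => p.1 ∩ p.2

/-- Unpacking `tcompat`. [this work] -/
theorem tcompat_eq_true_iff (t u : ℕ × Bool) : tcompat t u = true ↔ (t.1 = u.1 ↔ t.2 ≠ u.2) := by
  unfold tcompat
  by_cases h1 : t.1 = u.1 <;> by_cases h2 : t.2 = u.2 <;> simp [h1, h2]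

/-- Membership in `typeMeets`. [this work] -/
theorem mem_typeMeets_iff {Z : Finset (Finset α)} {L : Finset α → Finset (ℕ × Bool)} {w : Finset α} :
    w ∈ typeMeets Z L ↔ ∃ z ∈ Z, ∃ z' ∈ Z, lcompat (L z) (L z') = true ∧ z ∩ z' = w := by
  unfold typeMeets
  simp only [mem_image, mem_filter, mem_product, Prod.exists]
  constructor
  · rintro ⟨z, z', ⟨⟨hz, hz'⟩, hc⟩, rfl⟩; exact ⟨z, hz, z', hz', hc, rfl⟩
  · rintro ⟨z, hz, z', hz', hc, rfl⟩; exact ⟨z, z', ⟨⟨hz, hz'⟩, hc⟩, rfl⟩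

/-! ### 2. The typed statement -/

/-- **CONJECTURE (type-set signed coloured Daykin; typed).**  Let `Z ⊆ 2^G` be closed under complement in `G`, and let every member
carry a nonempty type-set `L z ⊆ ℕ × Bool` with `L (G \ z) = flipT '' (L z)`.  Then
`#Z + #{z ∈ Z : lcompat (L z) (L z)} ≤ 2 · #typeMeets Z L` — i.e. the number of compatible meets is at least the number of antipodal
pairs plus the number of self-compatible antipodal pairs.  Singleton type-sets: `PartitionSignedDaykin`
(`partitionSignedDaykin_of_typeSetSignedDaykin`).  Evidence in the file header. [this work] [status: open] -/
@[conjecture] def TypeSetSignedDaykin (α : Type*) [DecidableEq α] : Prop :=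
  ∀ (G : Finset α) (Z : Finset (Finset α)) (L : Finset α → Finset (ℕ × Bool)),
    (∀ z ∈ Z, z ⊆ G) → (∀ z ∈ Z, G \ z ∈ Z) → (∀ z ∈ Z, (L z).Nonempty) →
    (∀ z ∈ Z, L (G \ z) = (L z).image flipT) →
    #Z + #(Z.filter fun z => lcompat (L z) (L z) = true) ≤ 2 * #(typeMeets Z L)

/-! ### 3. The reduction to `PartitionSignedDaykin` -/

section reduction

variable {F : Finset α} {P : Finset (Finset α)} {κ : Finset α → ℕ}

/-- The type-set labelling of the signed family `P ⊔ σP` generated by a labelled complement-free `P ⊆ 2^F`: a member `S ∈ P` gets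
`{(κ S, true)}`, a complement `F \ S` gets `{(κ S, false)}`. [this work] -/
def signedTypes (F : Finset α) (P : Finset (Finset α)) (κ : Finset α → ℕ) (w : Finset α) : Finset (ℕ × Bool) :=
  (if w ∈ P then {(κ w, true)} else ∅) ∪ (if F \ w ∈ P ∧ w ⊆ F then {(κ (F \ w), false)} else ∅)

/-- Types of a positive member. [this work] -/
theorem signedTypes_of_mem (hcf : ∀ S ∈ P, F \ S ∉ P) {S : Finset α} (hS : S ∈ P) :
    signedTypes F P κ S = {(κ S, true)} := by
  unfold signedTypes
  have h2 : ¬ (F \ S ∈ P ∧ S ⊆ F) := fun h => hcf S hS h.1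
  rw [if_pos hS, if_neg h2, union_empty]

/-- Types of a negative member. [this work] -/
theorem signedTypes_of_sdiff_mem (hPF : ∀ S ∈ P, S ⊆ F) (hcf : ∀ S ∈ P, F \ S ∉ P) {S : Finset α} (hS : S ∈ P) :
    signedTypes F P κ (F \ S) = {(κ S, false)} := by
  unfold signedTypes
  have hSF := hPF S hS
  have h1 : F \ S ∉ P := hcf S hS
  have h2 : F \ (F \ S) ∈ P ∧ F \ S ⊆ F := by rw [Finset.sdiff_sdiff_eq_self hSF]; exact ⟨hS, sdiff_subset⟩
  rw [if_neg h1, if_pos h2, empty_union, Finset.sdiff_sdiff_eq_self hSF]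

/-- Members of `P ∪ σP` are positive members or complements of positive members. [this work] -/
theorem mem_union_image_sdiff_iff {w : Finset α} :
    w ∈ P ∪ P.image (fun S => F \ S) ↔ w ∈ P ∨ ∃ S ∈ P, F \ S = w := by
  simp only [mem_union, mem_image]

/-- A type of a member of `P ∪ σP` is `(κ S, true)` at `S` or `(κ S, false)` at `F \ S`. [this work] -/
theorem mem_signedTypes (hPF : ∀ S ∈ P, S ⊆ F) (hcf : ∀ S ∈ P, F \ S ∉ P) {w : Finset α}
    (hw : w ∈ P ∪ P.image (fun S => F \ S)) {t : ℕ × Bool} (ht : t ∈ signedTypes F P κ w) :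
    (w ∈ P ∧ t = (κ w, true)) ∨ (∃ S ∈ P, w = F \ S ∧ t = (κ S, false)) := by
  rcases mem_union_image_sdiff_iff.1 hw with hwP | ⟨S, hS, rfl⟩
  · rw [signedTypes_of_mem hcf hwP, mem_singleton] at ht
    exact Or.inl ⟨hwP, ht⟩
  · rw [signedTypes_of_sdiff_mem hPF hcf hS, mem_singleton] at ht
    exact Or.inr ⟨S, hS, rfl, ht⟩

/-- The compatible meets of the signed family are partition differences. [this work] -/
theorem typeMeets_signed_subset_partDiffs (hPF : ∀ S ∈ P, S ⊆ F) (hcf : ∀ S ∈ P, F \ S ∉ P) :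
    typeMeets (P ∪ P.image (fun S => F \ S)) (signedTypes F P κ) ⊆ partDiffs F P κ := by
  intro w hw
  obtain ⟨z, hz, z', hz', hcl, rfl⟩ := mem_typeMeets_iff.1 hw
  obtain ⟨t, ht, u, hu, hc⟩ := (lcompat_iff _ _).1 hcl
  rw [tcompat_eq_true_iff] at hc
  unfold partDiffs
  simp only [mem_union, mem_image, mem_filter, mem_product, Prod.exists]
  rcases mem_signedTypes hPF hcf hz ht with ⟨hzP, rfl⟩ | ⟨S, hS, rfl, rfl⟩ <;>
    rcases mem_signedTypes hPF hcf hz' hu with ⟨hz'P, rfl⟩ | ⟨S', hS', rfl, rfl⟩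
  · -- positive, positive: compatible iff classes differ
    have hne : κ z ≠ κ z' := by simpa using hc
    exact Or.inr (Or.inl ⟨z, z', ⟨⟨hzP, hz'P⟩, hne⟩, rfl⟩)
  · -- positive z, negative F \ S': compatible iff classes equal; z ∩ (F \ S') = z \ S'
    have heq : κ z = κ S' := by simpa using hc
    refine Or.inl ⟨z, S', ⟨⟨hzP, hS'⟩, heq⟩, ?_⟩
    ext a; have := fun (h : a ∈ z) => hPF z hzP h
    simp only [mem_sdiff, mem_inter]; tauto
  · -- negative F \ S, positive z'
    have heq : κ S = κ z' := by simpa using hc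
    refine Or.inl ⟨z', S, ⟨⟨hz'P, hS⟩, heq.symm⟩, ?_⟩
    ext a; have := fun (h : a ∈ z') => hPF z' hz'P h
    simp only [mem_sdiff, mem_inter]; tauto
  · -- negative, negative: classes differ; (F \ S) ∩ (F \ S') = F \ (S ∪ S')
    have hne : κ S ≠ κ S' := by simpa using hc
    refine Or.inr (Or.inr ⟨S, S', ⟨⟨hS, hS'⟩, hne⟩, ?_⟩)
    ext a; simp only [mem_sdiff, mem_union, mem_inter]; tauto

/-- **`TypeSetSignedDaykin ⟹ PartitionSignedDaykin`.**  Apply the conjecture to `Z = P ∪ σP` with the singleton type-sets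
`signedTypes`: every hypothesis holds, `#Z = 2·#P`, and the compatible meets are partition differences. [this work] -/
theorem partitionSignedDaykin_of_typeSetSignedDaykin (h : TypeSetSignedDaykin α) : PartitionSignedDaykin α := by
  intro F P κ hPF hcf
  set N := P.image (fun S => F \ S) with hN
  set Z := P ∪ N with hZ
  set L := signedTypes F P κ with hL
  -- hypotheses of the conjecture
  have hZG : ∀ z ∈ Z, z ⊆ F := by
    intro z hz
    rcases mem_union_image_sdiff_iff.1 hz with hzP | ⟨S, _, rfl⟩
    · exact hPF z hzP
    · exact sdiff_subset
  have hcc : ∀ z ∈ Z, F \ z ∈ Z := by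
    intro z hz
    rcases mem_union_image_sdiff_iff.1 hz with hzP | ⟨S, hS, rfl⟩
    · exact mem_union.2 (Or.inr (mem_image.2 ⟨z, hzP, rfl⟩))
    · rw [Finset.sdiff_sdiff_eq_self (hPF S hS)]; exact mem_union.2 (Or.inl hS)
  have hne : ∀ z ∈ Z, (L z).Nonempty := by
    intro z hz
    rcases mem_union_image_sdiff_iff.1 hz with hzP | ⟨S, hS, rfl⟩
    · rw [hL, signedTypes_of_mem hcf hzP]; exact singleton_nonempty _
    · rw [hL, signedTypes_of_sdiff_mem hPF hcf hS]; exact singleton_nonempty _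
  have hflip : ∀ z ∈ Z, L (F \ z) = (L z).image flipT := by
    intro z hz
    rcases mem_union_image_sdiff_iff.1 hz with hzP | ⟨S, hS, rfl⟩
    · rw [hL, signedTypes_of_mem hcf hzP, signedTypes_of_sdiff_mem hPF hcf hzP, image_singleton]; rfl
    · rw [hL, Finset.sdiff_sdiff_eq_self (hPF S hS), signedTypes_of_mem hcf hS, signedTypes_of_sdiff_mem hPF hcf hS,
        image_singleton]
      simp [flipT]
  have key := h F Z L hZG hcc hne hflip
  -- #Z = 2·#P
  have hdisj : Disjoint P N := by
    rw [disjoint_left]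
    intro S hS hSN
    obtain ⟨S', hS', hSS'⟩ := mem_image.1 hSN
    exact hcf S' hS' (hSS' ▸ hS)
  have hinj : Set.InjOn (fun S => F \ S) ↑P := by
    intro S hS S' hS' hSS'
    have h1 := hPF S (mem_coe.1 hS); have h2 := hPF S' (mem_coe.1 hS')
    have : F \ (F \ S) = F \ (F \ S') := by simp only at hSS'; rw [hSS']
    rwa [Finset.sdiff_sdiff_eq_self h1, Finset.sdiff_sdiff_eq_self h2] at this
  have hcardZ : #Z = 2 * #P := by
    rw [hZ, card_union_of_disjoint hdisj, hN, card_image_of_injOn hinj]; ring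
  have hsub := card_le_card (typeMeets_signed_subset_partDiffs (κ := κ) hPF hcf)
  have : 2 * #P ≤ 2 * #(partDiffs F P κ) :=
    calc 2 * #P = #Z := hcardZ.symm
      _ ≤ #Z + #(Z.filter fun z => lcompat (L z) (L z) = true) := Nat.le_add_right _ _
      _ ≤ 2 * #(typeMeets Z L) := key
      _ ≤ 2 * #(partDiffs F P κ) := Nat.mul_le_mul_left 2 hsub
  omega

end reduction

end Summit.CriticalPhenomena.PercolationContinuityZ3.Theorems.SahiColouredDaykin
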